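import Literature.NumberTheory.Automorphic.WeightForms
import HarnessLib

/-!
# Weight forms — restriction to a component group (the adelic → archimedean dictionary)

Companion to `Literature.NumberTheory.Automorphic.WeightForms` (`weightForms Γ κ τ`, the `W`-valued
functions on a group `G` that are left `Γ`-invariant and right `τ`-equivariant for `κ : Kc →* G`).

For `G(𝔸_F) = G(F_∞) × G(𝔸_F^∞)`, an adelic form `F` of level `K_f` and `K_∞`-type `τ` restricts along the
archimedean component `ι_∞ : G(F_∞) → G(𝔸_F)`, `x ↦ (x, 1)`, to a classical form `x ↦ F(ι_∞ x)` on
`G(F_∞)` for the arithmetic group `Δ = {δ ∈ G(F) | δ_f ∈ K_f}` (seen in `G(F_∞)`), of the same `K_∞`-type —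
the identity-component piece of the dictionary `𝒜(G(F)\G(𝔸_F)/K_f)_τ = ⊕ᵢ 𝒜(Γᵢ\G(F_∞))_τ` over the double
cosets `G(F) gᵢ G(F_∞) K_f` (Getz–Hahn §6.3–6.4, Borel 1997 §5; for a unitary group of a hermitian space
over a CM field and its ball quotients `Γᵢ\𝔹²` this is how adelic theta forms become vector-valued automorphic
forms on the ball).

Everything here is elementary group bookkeeping [folklore], stated ABSTRACTLY over a homomorphism
`ι : G₁ →* GU` and hypotheses that the concrete product situation discharges by `rfl`/`simp`:
* `comp_mem_weightForms` — if every `δ ∈ Δ` is corrected into `ΓU` by a level element `κ c` (`τ c = 1`)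
  commuting with `ι(G₁)`, and the weight of `G₁` is matched through a hom `η₁ : K₁ →* Kc`
  (`κ (η₁ u) = ι (κ₁ u)`, `τ (η₁ u) = τ₁ u`), then `F ∘ ι ∈ weightForms Δ κ₁ τ₁` for `F ∈ weightForms ΓU κ τ`;
* `restrictHom` — the `R`-linear restriction map `weightForms ΓU κ τ →ₗ[R] weightForms Δ κ₁ τ₁`,
  `restrictHom_apply : restrictHom … F x = F (ι x)`;
* `restrictHom_ne_zero_of_apply_ne_zero` — a form with `F (ι x) ≠ 0` restricts to a nonzero form (only the
  double coset through `ι` is seen: non-vanishing must be witnessed ON it, e.g. at `g₀ = 1`);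
* `comp_rightTranslate` — restriction intertwines right translation by `ι h₁` upstairs with right
  translation by `h₁` downstairs (`F (ι (x h₁)) = F (ι x · ι h₁)`);
* `comp_leftTranslate_eq(_of_mem)` — a RATIONAL left translate downstairs is a LEVEL right translate upstairs:
  `γ = ι γ₁ · k ∈ ΓU`, `k` commuting with `ι(G₁)` ⇒ `F (ι (γ₁ x)) = F (ι x · k⁻¹)` (the seam behind
  `γ^* u_F = u_{R(γ_f⁻¹) F}` for Hecke translates of classical forms by rational elements).
-/

namespace Literature.NumberTheory.Automorphic.WeightForms

variable {GU : Type*} [Group GU] {G₁ : Type*} [Group G₁]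
variable {Kc : Type*} [Group Kc] {K₁ : Type*} [Group K₁]
variable {R : Type*} [CommRing R] {W : Type*} [AddCommGroup W] [Module R W]
variable {ΓU : Subgroup GU} {κ : Kc →* GU} {τ : Representation R Kc W}
variable (ι : G₁ →* GU) {Δ : Subgroup G₁} {κ₁ : K₁ →* G₁} {τ₁ : Representation R K₁ W}

/-- The hypothesis on the arithmetic group `Δ ≤ G₁`: every `δ ∈ Δ` becomes an element of `ΓU` after right
multiplication by a LEVEL element `κ c` (`τ c = 1`) commuting with `ι(G₁)` — for `G(𝔸) = G_∞ × G(𝔸_f)`,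
`ΓU = G(F)`, `Δ = {δ ∈ G(F) | δ_f ∈ K_f}`: `c = (δ_f⁻¹… )`, i.e. `ι(δ_∞) · (1, δ_f) = δ ∈ G(F)`. [folklore] -/
def IsLevelCorrected (ΓU : Subgroup GU) (κ : Kc →* GU) (τ : Representation R Kc W) (ι : G₁ →* GU)
    (Δ : Subgroup G₁) : Prop :=
  ∀ δ ∈ Δ, ∃ c : Kc, τ c = 1 ∧ ι δ * κ c ∈ ΓU ∧ ∀ x : G₁, Commute (κ c) (ι x)

/-- The hypothesis matching the weights: a hom `η₁ : K₁ →* Kc` over `ι` (`κ ∘ η₁ = ι ∘ κ₁`) along which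
`τ` restricts to `τ₁` — for `Kc = K_f × K_∞`, `K₁ = K_∞`: `η₁ u = (1, u)`. [folklore] -/
def IsWeightMatched (κ : Kc →* GU) (τ : Representation R Kc W) (ι : G₁ →* GU) (κ₁ : K₁ →* G₁)
    (τ₁ : Representation R K₁ W) (η₁ : K₁ →* Kc) : Prop :=
  (∀ u : K₁, κ (η₁ u) = ι (κ₁ u)) ∧ ∀ u : K₁, τ (η₁ u) = τ₁ u

/-- **Restriction along `ι` preserves forms**: `F ∈ weightForms ΓU κ τ ⇒ F ∘ ι ∈ weightForms Δ κ₁ τ₁` under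
`IsLevelCorrected` and `IsWeightMatched`. [folklore] -/
theorem comp_mem_weightForms (hΔ : IsLevelCorrected ΓU κ τ ι Δ) {η₁ : K₁ →* Kc}
    (hη : IsWeightMatched κ τ ι κ₁ τ₁ η₁) {F : GU → W} (hF : F ∈ weightForms ΓU κ τ) :
    (F ∘ ι) ∈ weightForms Δ κ₁ τ₁ := by
  refine ⟨fun δ hδ x => ?_, fun u x => ?_⟩
  · obtain ⟨c, hc1, hγ, hcomm⟩ := hΔ δ hδ
    show F (ι (δ * x)) = F (ι x)
    have key : ι (δ * x) = (ι δ * κ c) * (ι x * κ c⁻¹) := by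
      rw [map_mul, map_inv, mul_assoc, ← mul_assoc (κ c), (hcomm x).eq, mul_assoc, mul_inv_cancel, mul_one]
    rw [key, hF.1 _ hγ, hF.2 c⁻¹ (ι x), inv_inv, hc1, Module.End.one_apply]
  · show F (ι (x * κ₁ u)) = τ₁ u⁻¹ (F (ι x))
    rw [map_mul, ← hη.1 u, hF.2 (η₁ u) (ι x), ← map_inv, hη.2]

/-- **The restriction map** `weightForms ΓU κ τ →ₗ[R] weightForms Δ κ₁ τ₁`, `F ↦ F ∘ ι` (adelic forms of level
`K_f` and type `τ` ↦ classical forms for `Δ` of type `τ` on the identity double coset). [folklore] -/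
def restrictHom (hΔ : IsLevelCorrected ΓU κ τ ι Δ) {η₁ : K₁ →* Kc} (hη : IsWeightMatched κ τ ι κ₁ τ₁ η₁) :
    weightForms ΓU κ τ →ₗ[R] weightForms Δ κ₁ τ₁ where
  toFun F := ⟨(F : GU → W) ∘ ι, comp_mem_weightForms ι hΔ hη F.2⟩
  map_add' _ _ := rfl
  map_smul' _ _ := rfl

/-- `restrictHom` on points: `(restrictHom F) x = F (ι x)`. [folklore] -/
@[simp] theorem restrictHom_apply (hΔ : IsLevelCorrected ΓU κ τ ι Δ) {η₁ : K₁ →* Kc}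
    (hη : IsWeightMatched κ τ ι κ₁ τ₁ η₁) (F : weightForms ΓU κ τ) (x : G₁) :
    (restrictHom ι hΔ hη F : G₁ → W) x = (F : GU → W) (ι x) := rfl

/-- **Non-vanishing on the visible component**: if `F (ι x) ≠ 0` for some `x`, the restricted form is
nonzero. (An adelic form may vanish identically on `ι(G₁)` and live on another double coset; non-vanishing
must be witnessed through `ι`, e.g. at `g₀ = 1 = ι 1`.) [folklore] -/
theorem restrictHom_ne_zero_of_apply_ne_zero (hΔ : IsLevelCorrected ΓU κ τ ι Δ) {η₁ : K₁ →* Kc}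
    (hη : IsWeightMatched κ τ ι κ₁ τ₁ η₁) {F : weightForms ΓU κ τ} {x : G₁} (hx : (F : GU → W) (ι x) ≠ 0) :
    restrictHom ι hΔ hη F ≠ 0 := by
  intro h0
  apply hx
  have := congrArg (fun f : weightForms Δ κ₁ τ₁ => (f : G₁ → W) x) h0
  simpa using this

/-- Conversely the restricted form vanishes iff `F` vanishes on `ι(G₁)`. [folklore] -/
theorem restrictHom_eq_zero_iff (hΔ : IsLevelCorrected ΓU κ τ ι Δ) {η₁ : K₁ →* Kc}
    (hη : IsWeightMatched κ τ ι κ₁ τ₁ η₁) (F : weightForms ΓU κ τ) :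
    restrictHom ι hΔ hη F = 0 ↔ ∀ x : G₁, (F : GU → W) (ι x) = 0 := by
  constructor
  · intro h0 x
    have := congrArg (fun f : weightForms Δ κ₁ τ₁ => (f : G₁ → W) x) h0
    simpa using this
  · intro h
    exact Subtype.ext (funext fun x => by simpa using h x)

omit [AddCommGroup W] in
/-- **Restriction and right translation**: restricting the right translate of `F` by `ι h₁` is right
translating the restriction by `h₁` — as an identity of functions `G₁ → W` (both sides are
`x ↦ F (ι x · ι h₁)`), whatever weight spaces one reads them in. [folklore] -/
theorem comp_rightTranslate (F : GU → W) (h₁ : G₁) :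
    (fun g => F (g * ι h₁)) ∘ ι = fun x => (F ∘ ι) (x * h₁) := by
  funext x
  simp [map_mul]

omit [Group Kc] [CommRing R] [AddCommGroup W] [Module R W] in
/-- **Rational left translates downstairs are level translates upstairs** (the seam behind
`γ^* u_F = u_{R(γ_f⁻¹) F}`, N33b): if `γ = ι γ₁ · k ∈ ΓU` with `k` commuting with `ι(G₁)` (a rational element
with archimedean component `γ₁` and finite component `k`), then for a left-`ΓU`-invariant `F`,
`F (ι (γ₁ x)) = F (ι x · k⁻¹)` for all `x`. [folklore] -/
theorem comp_leftTranslate_eq {F : GU → W} (hF : ∀ γ ∈ ΓU, ∀ g, F (γ * g) = F g) {γ₁ : G₁} {k : GU}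
    (hγ : ι γ₁ * k ∈ ΓU) (hk : ∀ x : G₁, Commute k (ι x)) (x : G₁) :
    F (ι (γ₁ * x)) = F (ι x * k⁻¹) := by
  have key : ι (γ₁ * x) = (ι γ₁ * k) * (ι x * k⁻¹) := by
    rw [map_mul, mul_assoc, ← mul_assoc k, (hk x).eq, mul_assoc, mul_inv_cancel, mul_one]
  rw [key, hF _ hγ]

/-- The same for a weight form `F ∈ weightForms ΓU κ τ`. [folklore] -/
theorem comp_leftTranslate_eq_of_mem {F : GU → W} (hF : F ∈ weightForms ΓU κ τ) {γ₁ : G₁} {k : GU}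
    (hγ : ι γ₁ * k ∈ ΓU) (hk : ∀ x : G₁, Commute k (ι x)) (x : G₁) :
    F (ι (γ₁ * x)) = F (ι x * k⁻¹) :=
  comp_leftTranslate_eq ι hF.1 hγ hk x

/-- The level-corrected hypothesis is inherited by subgroups of `Δ`. [folklore] -/
theorem IsLevelCorrected.mono {Δ Δ' : Subgroup G₁} (h : Δ' ≤ Δ) (hΔ : IsLevelCorrected ΓU κ τ ι Δ) :
    IsLevelCorrected ΓU κ τ ι Δ' :=
  fun δ hδ => hΔ δ (h hδ)

/-! ### The product situation `GU = G₁ × G₂` (archimedean × finite-adelic) -/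

section Prod

variable {G₂ : Type*} [Group G₂] {K₂ : Type*} [Group K₂]

/-- In the product situation `GU = G₁ × G₂`, weight group `K₁ × K₂` mapped by `κ₁ × κ₂`, weight
`τ₁ ⊗ (trivial on K₂)` written as `τ` with `τ (u, 1) = τ₁ u` and `τ (1, k) = 1`: the arithmetic group
`Δ = {δ | ∃ k : K₂, (δ, κ₂ k) ∈ ΓU}` is level-corrected. [folklore] -/
theorem isLevelCorrected_prod (ΓU : Subgroup (G₁ × G₂)) (κ₁ : K₁ →* G₁) (κ₂ : K₂ →* G₂)
    (τ : Representation R (K₁ × K₂) W) (hτ : ∀ k : K₂, τ (1, k) = 1) (Δ : Subgroup G₁)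
    (hΔ : ∀ δ ∈ Δ, ∃ k : K₂, ((δ, κ₂ k) : G₁ × G₂) ∈ ΓU) :
    IsLevelCorrected ΓU (κ₁.prodMap κ₂) τ (MonoidHom.inl G₁ G₂) Δ := by
  intro δ hδ
  obtain ⟨k, hk⟩ := hΔ δ hδ
  refine ⟨(1, k), hτ k, ?_, fun x => ?_⟩
  · simpa [MonoidHom.prodMap, MonoidHom.inl_apply] using hk
  · simp only [MonoidHom.prodMap_def, MonoidHom.prod_apply, MonoidHom.coe_comp, Function.comp_apply,
      MonoidHom.coe_fst, MonoidHom.coe_snd, map_one, MonoidHom.inl_apply]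
    exact Commute.prod (Commute.one_left x) (Commute.one_right (κ₂ k))

/-- In the product situation the weights are matched through `η₁ = inl : K₁ → K₁ × K₂`. [folklore] -/
theorem isWeightMatched_prod (κ₁ : K₁ →* G₁) (κ₂ : K₂ →* G₂) (τ : Representation R (K₁ × K₂) W)
    (τ₁ : Representation R K₁ W) (hτ : ∀ u : K₁, τ (u, 1) = τ₁ u) :
    IsWeightMatched (κ₁.prodMap κ₂) τ (MonoidHom.inl G₁ G₂) κ₁ τ₁ (MonoidHom.inl K₁ K₂) :=
  ⟨fun u => by simp [MonoidHom.prodMap_def, MonoidHom.inl_apply], hτ⟩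

end Prod

end Literature.NumberTheory.Automorphic.WeightForms
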